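import Summits.QuantumFields.QCD.Theorems.QuarksAsStableActionStableActionBridgeSliceNilpotent
import Summits.QuantumFields.QCD.Theorems.QuarksAsStableActionStableActionBridgeSliceMassHopPosDef

/-!
# Gauge covariance of the one-particle fermionic transfer matrix `M_F(U)` and gauge invariance
# of `det A(U)`
(helper for crux stmt-QuantumFields-9737 `QuarksAsStableAction.StableActionBridge`, line `Sketch`;
stubs `fermionSliceMatrix_gaugeTransform` and `det_sliceMassHop_gaugeTransform`)

A time-independent gauge transformation `g : x ↦ g(x) ∈ SU(3)` of the spatial three-torus acts on
the spatial links by `U(x,j) ↦ g(x) U(x,j) g(x+ĵ)⁻¹` (the tree's `gaugeTransform`) and on the quark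
modes of one time slice by the block-diagonal, flavour- and spin-blind colour rotation
`ψ_{f,x,a,α} ↦ Σ_b g(x)_{ab} ψ_{f,x,b,α}` (Smit, *Introduction to Quantum Fields on a Lattice*,
§4.6 (4.124)–(4.126)), whose one-particle matrix is the tree's `sliceGaugeRot g = R_g ⊗ 1₄` with
the colour-level rotation `(R_g)_{(f,x,a),(f',x',b)} = δ_{ff'} δ_{xx'} g(x)_{ab}`.

We prove, for every `SU(3)` background `U` and all bare masses (no positivity of `A` is needed):

* `colourHop_gaugeTransform`: the forward colour hop is covariant, `W_j(U^g) = R_g W_j(U) R_gᴴ`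
  (on its support `x' = x + ĵ` the entry is `(g(x) U(x,j) g(x+ĵ)ᴴ)_{ab}`), hence so are `W_jᴴ`,
  Smit's `A(U) = diag(m_f + 4) − ½Σ_j (W_j + W_jᴴ)` (`sliceMassHop_gaugeTransform`; the mass term is
  flavour-diagonal and commutes with `R_g`, and `R_g R_gᴴ = 1`), its junk-free inverse
  (`(R A Rᴴ)⁻¹ = R A⁻¹ Rᴴ` for Mathlib's nonsingular inverse, by `Matrix.mul_inv_rev` and
  `R⁻¹ = Rᴴ`), `D(U)`, the pair coupling `N = (1 ⊗ P⁻) D (1 ⊗ P⁺)` and `Nᴴ` (lifted to spin with the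
  `sliceKron` toolkit of `SliceNilpotent`: `(R ⊗ 1)(X ⊗ Γ)(Rᴴ ⊗ 1) = (R X Rᴴ) ⊗ Γ`);
* `fermionSliceMatrix_gaugeTransform` (registered stub): inserting `(Rᴴ ⊗ 1)(R ⊗ 1) = 1` between
  the three covariant factors of `M_F(U) = (1 − N)(A⁻¹ ⊗ P⁺ + A ⊗ P⁻)(1 − Nᴴ)` gives
  `M_F(U^g) = (R_g ⊗ 1) M_F(U) (R_g ⊗ 1)ᴴ` (Smit §6.5 (6.91) with §4.6 (4.127));
* `det_sliceMassHop_gaugeTransform` (registered stub): `det A(U^g) = det A(U)`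
  (`det R_g · det R_gᴴ = det (R_g R_gᴴ) = 1`), the gauge invariance of the Dirac-sea factor
  `(det A)²` of `T̂_F(U)`.

The colour rotation is handled through a characterising hypothesis
`hR : ∀ p q, R p q = if p.1 = q.1 ∧ p.2.1 = q.2.1 then g(p.2.1)_{p.2.2 q.2.2} else 0` on an abstract
matrix `R` (pure theorem file, no definitions); the registered statements instantiate `R` with the
literal spin-blind factor of `sliceGaugeRot g` (by `rfl`).
[cite: Smit2023, §4.6 (4.124)–(4.127) and §6.5 (6.91)]
-/

noncomputable section

namespace Summit.QuantumFields.QCD.Cruxes.StableActionBridge.Sketch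

open MeasureTheory Matrix Literature.MathematicalPhysics.QuantumFieldTheory
  Literature.MathematicalPhysics.QuantumLattice
open Literature.Probability.LatticeModels (TorusSite)

namespace FermionSliceCovariance

/-! ### Two abstract matrix identities -/

/-- Three conjugated factors multiply to the conjugate of the product when `K'K = 1`:
`(K X K')(K Y K')(K Z K') = K (X Y Z) K'`. -/
theorem conj_mul_conj_mul_conj {n : Type*} [Fintype n] [DecidableEq n]
    (K K' X Y Z : Matrix n n ℂ) (h : K' * K = 1) :
    K * X * K' * (K * Y * K') * (K * Z * K') = K * (X * Y * Z) * K' := by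
  have h' : ∀ W : Matrix n n ℂ, K' * (K * W) = W := fun W => by
    rw [← Matrix.mul_assoc, h, Matrix.one_mul]
  simp only [Matrix.mul_assoc, h']

/-- `1 − K N K' = K (1 − N) K'` when `K K' = 1`. -/
theorem one_sub_conj {n : Type*} [Fintype n] [DecidableEq n] (K K' N : Matrix n n ℂ)
    (h : K * K' = 1) : 1 - K * N * K' = K * (1 - N) * K' := by
  rw [Matrix.mul_sub, Matrix.sub_mul, Matrix.mul_one, h]

variable {Nf S : ℕ} [NeZero S]

section ColourRotation

variable (g : TorusSite 3 S → Matrix.specialUnitaryGroup (Fin 3) ℂ)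
  (R : Matrix (SliceColourVar Nf S) (SliceColourVar Nf S) ℂ)
  (hR : ∀ p q, R p q =
    if p.1 = q.1 ∧ p.2.1 = q.2.1 then (g p.2.1 : Matrix (Fin 3) (Fin 3) ℂ) p.2.2 q.2.2 else 0)
include hR

/-! ### The colour rotation `R_g`: entrywise action and unitarity -/

/-- Left multiplication by the colour rotation acts on the colour index at fixed flavour and site:
`(R A)_{(f,x,a),q} = Σ_b g(x)_{ab} A_{(f,x,b),q}`. -/
theorem rot_mul_apply {Y : Type*} (A : Matrix (SliceColourVar Nf S) Y ℂ) (p : SliceColourVar Nf S)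
    (q : Y) :
    (R * A) p q =
      ∑ b : Fin 3, (g p.2.1 : Matrix (Fin 3) (Fin 3) ℂ) p.2.2 b * A (p.1, p.2.1, b) q := by
  rw [Matrix.mul_apply, Fintype.sum_prod_type,
    Finset.sum_eq_single_of_mem p.1 (Finset.mem_univ _)]
  · rw [Fintype.sum_prod_type, Finset.sum_eq_single_of_mem p.2.1 (Finset.mem_univ _)]
    · refine Finset.sum_congr rfl fun b _ => ?_
      rw [hR, if_pos]
      exact ⟨rfl, rfl⟩
    · intro x _ hx
      refine Finset.sum_eq_zero fun b _ => ?_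
      rw [hR, if_neg, zero_mul]
      exact fun h => hx h.2.symm
  · intro f _ hf
    refine Finset.sum_eq_zero fun y _ => ?_
    rw [hR, if_neg, zero_mul]
    exact fun h => hf h.1.symm

/-- Right multiplication by the adjoint colour rotation:
`(A Rᴴ)_{p,(f,x,a)} = Σ_b A_{p,(f,x,b)} conj(g(x)_{ab})`. -/
theorem mul_rot_conjTranspose_apply {Y : Type*} (A : Matrix Y (SliceColourVar Nf S) ℂ) (p : Y)
    (q : SliceColourVar Nf S) :
    (A * Rᴴ) p q =
      ∑ b : Fin 3, A p (q.1, q.2.1, b) * star ((g q.2.1 : Matrix (Fin 3) (Fin 3) ℂ) q.2.2 b) := by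
  rw [Matrix.mul_apply, Fintype.sum_prod_type,
    Finset.sum_eq_single_of_mem q.1 (Finset.mem_univ _)]
  · rw [Fintype.sum_prod_type, Finset.sum_eq_single_of_mem q.2.1 (Finset.mem_univ _)]
    · refine Finset.sum_congr rfl fun b _ => ?_
      rw [conjTranspose_apply, hR, if_pos]
      exact ⟨rfl, rfl⟩
    · intro x _ hx
      refine Finset.sum_eq_zero fun b _ => ?_
      rw [conjTranspose_apply, hR, if_neg, star_zero, mul_zero]
      exact fun h => hx h.2.symm
  · intro f _ hf
    refine Finset.sum_eq_zero fun y _ => ?_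
    rw [conjTranspose_apply, hR, if_neg, star_zero, mul_zero]
    exact fun h => hf h.1.symm

/-- **The colour rotation is a co-isometry**: `R Rᴴ = 1` (block by block `g(x) g(x)ᴴ = 1`). -/
theorem rot_mul_rot_conjTranspose : R * Rᴴ = 1 := by
  ext ⟨f, x, a⟩ ⟨f', x', a'⟩
  rw [mul_rot_conjTranspose_apply g R hR]
  simp only [hR]
  by_cases h : f = f' ∧ x = x'
  · obtain ⟨rfl, rfl⟩ := h
    have h2 := congrFun (congrFun (SliceMassHopPosDef.link_mul_conjTranspose (g x)) a) a'
    rw [Matrix.mul_apply] at h2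
    simp only [conjTranspose_apply] at h2
    simp only [and_self, if_true, h2, Matrix.one_apply, Prod.mk.injEq, true_and]
  · simp only [h, if_false, zero_mul, Finset.sum_const_zero, Matrix.one_apply, Prod.mk.injEq]
    rw [if_neg]
    exact fun hh => h ⟨hh.1, hh.2.1⟩

/-- **The colour rotation is an isometry**: `Rᴴ R = 1`. -/
theorem rot_conjTranspose_mul_rot : Rᴴ * R = 1 :=
  mul_eq_one_comm.1 (rot_mul_rot_conjTranspose g R hR)

/-- The nonsingular inverse of the colour rotation is its adjoint, and conversely. -/
theorem rot_inv_and_conjTranspose_inv : R⁻¹ = Rᴴ ∧ Rᴴ⁻¹ = R :=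
  ⟨Matrix.inv_eq_right_inv (rot_mul_rot_conjTranspose g R hR),
    Matrix.inv_eq_left_inv (rot_mul_rot_conjTranspose g R hR)⟩

/-- Conjugation by the colour rotation commutes with the nonsingular inverse, with NO invertibility
hypothesis: `(R A Rᴴ)⁻¹ = R A⁻¹ Rᴴ` (`Matrix.mul_inv_rev` holds for Mathlib's `Matrix.inv` in
general). -/
theorem inv_rot_conj (A : Matrix (SliceColourVar Nf S) (SliceColourVar Nf S) ℂ) :
    (R * A * Rᴴ)⁻¹ = R * A⁻¹ * Rᴴ := by
  obtain ⟨h1, h2⟩ := rot_inv_and_conjTranspose_inv g R hR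
  rw [Matrix.mul_inv_rev, Matrix.mul_inv_rev, h1, h2, Matrix.mul_assoc]

/-- Conjugation by the colour rotation preserves the determinant: `det (R A Rᴴ) = det A`. -/
theorem det_rot_conj (A : Matrix (SliceColourVar Nf S) (SliceColourVar Nf S) ℂ) :
    (R * A * Rᴴ).det = A.det := by
  have h1 : R.det * Rᴴ.det = 1 := by
    rw [← Matrix.det_mul, rot_mul_rot_conjTranspose g R hR, Matrix.det_one]
  rw [Matrix.det_mul, Matrix.det_mul, mul_right_comm, h1, one_mul]

/-! ### Covariance of the colour hops and of Smit's `A(U)` -/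

/-- **Gauge covariance of the forward colour hop**: `W_j(U^g) = R_g W_j(U) R_gᴴ`
(on the support `x' = x + ĵ` both sides are `(g(x) U(x,j) g(x+ĵ)ᴴ)_{ab}`, `g(x+ĵ)⁻¹ = g(x+ĵ)ᴴ` in
`SU(3)`). -/
theorem colourHop_gaugeTransform (U : GaugeConfig 3 S (Matrix.specialUnitaryGroup (Fin 3) ℂ))
    (j : Fin 3) : colourHop (Nf := Nf) (gaugeTransform g U) j = R * colourHop U j * Rᴴ := by
  ext ⟨f, x, a⟩ ⟨f', x', a'⟩
  rw [mul_rot_conjTranspose_apply g R hR]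
  simp_rw [rot_mul_apply g R hR]
  by_cases h : f = f' ∧ x' = Site.shift x j
  · obtain ⟨rfl, rfl⟩ := h
    have hcoe : ((gaugeTransform g U (x, j) : Matrix.specialUnitaryGroup (Fin 3) ℂ) :
        Matrix (Fin 3) (Fin 3) ℂ) =
        (g x : Matrix (Fin 3) (Fin 3) ℂ) * (U (x, j) : Matrix (Fin 3) (Fin 3) ℂ) *
          ((g (Site.shift x j) : Matrix (Fin 3) (Fin 3) ℂ))ᴴ := rfl
    simp only [colourHop, Matrix.of_apply, and_self, if_true, hcoe, Matrix.mul_apply,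
      Matrix.conjTranspose_apply]
  · simp only [colourHop, Matrix.of_apply, h, if_false, mul_zero, zero_mul, Finset.sum_const_zero]

/-- Gauge covariance of the backward colour hop: `W_j(U^g)ᴴ = R_g W_j(U)ᴴ R_gᴴ`. -/
theorem colourHop_conjTranspose_gaugeTransform
    (U : GaugeConfig 3 S (Matrix.specialUnitaryGroup (Fin 3) ℂ)) (j : Fin 3) :
    (colourHop (Nf := Nf) (gaugeTransform g U) j)ᴴ = R * (colourHop U j)ᴴ * Rᴴ := by
  rw [colourHop_gaugeTransform g R hR, Matrix.conjTranspose_mul, Matrix.conjTranspose_mul,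
    Matrix.conjTranspose_conjTranspose, Matrix.mul_assoc]

/-- The flavour-diagonal mass term commutes with the (flavour-preserving) colour rotation. -/
theorem rot_mul_massDiagonal_comm (mq : Fin Nf → ℝ) :
    R * Matrix.diagonal (fun p : SliceColourVar Nf S => ((mq p.1 + 4 : ℝ) : ℂ)) =
      Matrix.diagonal (fun p : SliceColourVar Nf S => ((mq p.1 + 4 : ℝ) : ℂ)) * R := by
  ext p q
  rw [Matrix.mul_diagonal, Matrix.diagonal_mul, hR]
  split_ifs with h
  · rw [h.1, mul_comm]
  · rw [zero_mul, mul_zero]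

/-- **Gauge covariance of Smit's `A(U)`** (Lüscher's `B`): `A(U^g) = R_g A(U) R_gᴴ`. -/
theorem sliceMassHop_gaugeTransform (U : GaugeConfig 3 S (Matrix.specialUnitaryGroup (Fin 3) ℂ))
    (mq : Fin Nf → ℝ) : sliceMassHop (gaugeTransform g U) mq = R * sliceMassHop U mq * Rᴴ := by
  have hdiag : R * Matrix.diagonal (fun p : SliceColourVar Nf S => ((mq p.1 + 4 : ℝ) : ℂ)) * Rᴴ =
      Matrix.diagonal (fun p : SliceColourVar Nf S => ((mq p.1 + 4 : ℝ) : ℂ)) := by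
    rw [rot_mul_massDiagonal_comm g R hR, Matrix.mul_assoc, rot_mul_rot_conjTranspose g R hR,
      Matrix.mul_one]
  unfold sliceMassHop
  rw [Matrix.mul_sub, Matrix.sub_mul, hdiag, Matrix.mul_smul, Matrix.smul_mul, Finset.mul_sum,
    Finset.sum_mul]
  simp_rw [colourHop_conjTranspose_gaugeTransform g R hR, colourHop_gaugeTransform g R hR,
    Matrix.mul_add, Matrix.add_mul]

/-! ### Lift to the spin index: covariance of `D(U)`, `N`, `Nᴴ` and `M_F(U)` -/

/-- `(R ⊗ 1)(Rᴴ ⊗ 1) = 1 = (Rᴴ ⊗ 1)(R ⊗ 1)` on the slice quark modes. -/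
theorem sliceKron_rot_mul_sliceKron_rot_conjTranspose :
    sliceKron R (1 : Matrix (Fin 4) (Fin 4) ℂ) * sliceKron Rᴴ 1 = 1 ∧
      sliceKron Rᴴ (1 : Matrix (Fin 4) (Fin 4) ℂ) * sliceKron R 1 = 1 := by
  rw [SliceNilpotent.sliceKron_mul, SliceNilpotent.sliceKron_mul, rot_mul_rot_conjTranspose g R hR,
    rot_conjTranspose_mul_rot g R hR, Matrix.mul_one, SliceNilpotent.sliceKron_one_one]
  exact ⟨rfl, rfl⟩

/-- **Gauge covariance of Smit's `D(U)`**: `D(U^g) = (R_g ⊗ 1) D(U) (R_gᴴ ⊗ 1)`. -/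
theorem sliceDiracKinetic_gaugeTransform
    (U : GaugeConfig 3 S (Matrix.specialUnitaryGroup (Fin 3) ℂ)) :
    sliceDiracKinetic (Nf := Nf) (gaugeTransform g U) =
      sliceKron R 1 * sliceDiracKinetic U * sliceKron Rᴴ 1 := by
  unfold sliceDiracKinetic
  rw [Matrix.mul_smul, Matrix.smul_mul, Finset.mul_sum, Finset.sum_mul]
  simp_rw [SliceNilpotent.sliceKron_mul, Matrix.one_mul, Matrix.mul_one, Matrix.mul_sub,
    Matrix.sub_mul, colourHop_conjTranspose_gaugeTransform g R hR, colourHop_gaugeTransform g R hR]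

/-- **Gauge covariance of the pair coupling** `N = (1 ⊗ P⁻) D (1 ⊗ P⁺)`:
`N(U^g) = (R_g ⊗ 1) N(U) (R_gᴴ ⊗ 1)` (the spin projections commute with `R_g ⊗ 1`). -/
theorem sliceNilp_gaugeTransform (U : GaugeConfig 3 S (Matrix.specialUnitaryGroup (Fin 3) ℂ)) :
    sliceNilp (Nf := Nf) (gaugeTransform g U) = sliceKron R 1 * sliceNilp U * sliceKron Rᴴ 1 := by
  unfold sliceNilp
  rw [sliceDiracKinetic_gaugeTransform g R hR]
  have h1 : sliceKron (1 : Matrix (SliceColourVar Nf S) (SliceColourVar Nf S) ℂ) timeProjMinus *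
      sliceKron R 1 = sliceKron R 1 * sliceKron 1 timeProjMinus := by
    rw [(SliceNilpotent.sliceKron_one_comm R timeProjMinus).1,
      (SliceNilpotent.sliceKron_one_comm R timeProjMinus).2]
  have h2 : sliceKron Rᴴ 1 *
      sliceKron (1 : Matrix (SliceColourVar Nf S) (SliceColourVar Nf S) ℂ) timeProjPlus =
        sliceKron 1 timeProjPlus * sliceKron Rᴴ 1 := by
    rw [(SliceNilpotent.sliceKron_one_comm Rᴴ timeProjPlus).1,
      (SliceNilpotent.sliceKron_one_comm Rᴴ timeProjPlus).2]
  calc sliceKron 1 timeProjMinus * (sliceKron R 1 * sliceDiracKinetic U * sliceKron Rᴴ 1) *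
        sliceKron 1 timeProjPlus
      = (sliceKron 1 timeProjMinus * sliceKron R 1) * sliceDiracKinetic U *
          (sliceKron Rᴴ 1 * sliceKron 1 timeProjPlus) := by simp only [Matrix.mul_assoc]
    _ = sliceKron R 1 *
          (sliceKron 1 timeProjMinus * sliceDiracKinetic U * sliceKron 1 timeProjPlus) *
          sliceKron Rᴴ 1 := by rw [h1, h2]; simp only [Matrix.mul_assoc]

/-- Gauge covariance of `Nᴴ = (1 ⊗ P⁺) D (1 ⊗ P⁻)`: `N(U^g)ᴴ = (R_g ⊗ 1) N(U)ᴴ (R_gᴴ ⊗ 1)`. -/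
theorem sliceNilp_conjTranspose_gaugeTransform
    (U : GaugeConfig 3 S (Matrix.specialUnitaryGroup (Fin 3) ℂ)) :
    (sliceNilp (Nf := Nf) (gaugeTransform g U))ᴴ =
      sliceKron R 1 * (sliceNilp U)ᴴ * sliceKron Rᴴ 1 := by
  rw [sliceNilp_gaugeTransform g R hR, Matrix.conjTranspose_mul, Matrix.conjTranspose_mul,
    SliceNilpotent.sliceKron_conjTranspose, SliceNilpotent.sliceKron_conjTranspose,
    Matrix.conjTranspose_conjTranspose, Matrix.conjTranspose_one, Matrix.mul_assoc]

/-- **Gauge covariance of the one-particle fermionic transfer matrix** (colour-rotation form):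
`M_F(U^g) = (R_g ⊗ 1) M_F(U) (R_gᴴ ⊗ 1)`. -/
theorem fermionSliceMatrix_gaugeTransform_rot
    (U : GaugeConfig 3 S (Matrix.specialUnitaryGroup (Fin 3) ℂ)) (mq : Fin Nf → ℝ) :
    fermionSliceMatrix (gaugeTransform g U) mq =
      sliceKron R 1 * fermionSliceMatrix U mq * sliceKron Rᴴ 1 := by
  obtain ⟨hKK', hK'K⟩ := sliceKron_rot_mul_sliceKron_rot_conjTranspose g R hR
  have hMid : sliceKron (sliceMassHop (gaugeTransform g U) mq)⁻¹ timeProjPlus +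
        sliceKron (sliceMassHop (gaugeTransform g U) mq) timeProjMinus =
      sliceKron R 1 * (sliceKron (sliceMassHop U mq)⁻¹ timeProjPlus +
        sliceKron (sliceMassHop U mq) timeProjMinus) * sliceKron Rᴴ 1 := by
    rw [sliceMassHop_gaugeTransform g R hR, inv_rot_conj g R hR, Matrix.mul_add, Matrix.add_mul]
    simp only [SliceNilpotent.sliceKron_mul, Matrix.one_mul, Matrix.mul_one]
  unfold fermionSliceMatrix
  rw [sliceNilp_conjTranspose_gaugeTransform g R hR, sliceNilp_gaugeTransform g R hR, hMid,
    one_sub_conj _ _ _ hKK', one_sub_conj _ _ _ hKK', conj_mul_conj_mul_conj _ _ _ _ _ hK'K]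

end ColourRotation

end FermionSliceCovariance

/-- **Stub `fermionSliceMatrix_gaugeTransform` of line `Sketch`: gauge covariance of the
one-particle fermionic transfer matrix.**  For every time-independent gauge transformation
`g : x ↦ g(x) ∈ SU(3)` of the spatial three-torus, every background `U` and all bare masses,
`M_F(U^g) = G_g M_F(U) G_gᴴ` with `G_g = sliceGaugeRot g = R_g ⊗ 1₄` the one-particle gauge
rotation of the slice quark modes (Smit §4.6 (4.124)–(4.127), §6.5 (6.91)).
[cite: Smit2023, §4.6 (4.124)–(4.127) and §6.5 (6.91)] -/
theorem fermionSliceMatrix_gaugeTransform : ∀ (Nf S : ℕ) [NeZero S] (g : Literature.Probability.LatticeModels.TorusSite 3 S → Matrix.specialUnitaryGroup (Fin 3) ℂ) (U : GaugeConfig 3 S (Matrix.specialUnitaryGroup (Fin 3) ℂ)) (mq : Fin Nf → ℝ), fermionSliceMatrix (gaugeTransform g U) mq = sliceGaugeRot (Nf := Nf) g * fermionSliceMatrix U mq * (sliceGaugeRot g)ᴴ := by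
  intro Nf S _ g U mq
  have e : sliceGaugeRot (Nf := Nf) g =
      sliceKron (Matrix.of fun p q : SliceColourVar Nf S =>
        if p.1 = q.1 ∧ p.2.1 = q.2.1 then (g p.2.1 : Matrix (Fin 3) (Fin 3) ℂ) p.2.2 q.2.2 else 0)
        1 := rfl
  rw [e, SliceNilpotent.sliceKron_conjTranspose, Matrix.conjTranspose_one]
  exact FermionSliceCovariance.fermionSliceMatrix_gaugeTransform_rot g _ (fun p q => rfl) U mq

/-- **Stub `det_sliceMassHop_gaugeTransform` of line `Sketch`: gauge invariance of `det A(U)`.**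
The determinant of Smit's spin-blind slice operator `A(U) = diag(m_f + 4) − ½Σ_j (W_j + W_jᴴ)`
(whose square is the Dirac-sea factor `e^{Tr P⁺ ln A}` of `T̂_F(U)`) is invariant under
time-independent gauge transformations: `A(U^g) = R_g A(U) R_gᴴ` with `R_g` unitary.
[cite: Smit2023, §4.6 (4.127) and §6.5 (6.91)] -/
theorem det_sliceMassHop_gaugeTransform : ∀ (Nf S : ℕ) [NeZero S] (g : Literature.Probability.LatticeModels.TorusSite 3 S → Matrix.specialUnitaryGroup (Fin 3) ℂ) (U : GaugeConfig 3 S (Matrix.specialUnitaryGroup (Fin 3) ℂ)) (mq : Fin Nf → ℝ), (sliceMassHop (Nf := Nf) (gaugeTransform g U) mq).det = (sliceMassHop (Nf := Nf) U mq).det := by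
  intro Nf S _ g U mq
  have hR : ∀ p q : SliceColourVar Nf S,
      (Matrix.of fun p q : SliceColourVar Nf S =>
        if p.1 = q.1 ∧ p.2.1 = q.2.1 then (g p.2.1 : Matrix (Fin 3) (Fin 3) ℂ) p.2.2 q.2.2 else 0)
        p q =
      if p.1 = q.1 ∧ p.2.1 = q.2.1 then (g p.2.1 : Matrix (Fin 3) (Fin 3) ℂ) p.2.2 q.2.2 else 0 :=
    fun p q => rfl
  rw [FermionSliceCovariance.sliceMassHop_gaugeTransform g _ hR U mq,
    FermionSliceCovariance.det_rot_conj g _ hR]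

end Summit.QuantumFields.QCD.Cruxes.StableActionBridge.Sketch

end
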